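/-
HONEST FRAMING: certified error envelopes and provably optimal rounding/accumulation schemes for
low-precision formats under stated cost models; every table by two implementations; no hardware
or vendor claims.
-/
/-
# T9(h) — THE PLACEMENT LAW under round-to-nearest-even

Venture CertifiedArithmetic / LowPrec, OPT seat gen 9 (OPTIMA.md §B, Theorem T9(h)).
-/
import Summits.Ventures.CertifiedArithmetic.LowPrec.OptChainLabelsPlacement

/-!
# The placement law under round-to-nearest-even (T9(h), RNE clauses)

`OptChainLabelsPlacement.lean` gives the exact worst case `1 + U(w)` of every placement `w` of
`k` wide (`F(q)`) additions among `n` narrow (`F(p)`) ones over ALL round-to-nearest families.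
Here: for `q ≥ p + 2` EVERY ties-to-even family attains `1 + U(w)` on every placement
(`placement_rne_attained` — every demotion is fed two or more bits wider, the RNE criterion of
T9(f)(ii), `rneGap_placePat`); for `q = p + 1` every ties-to-even family is STRICT on every
placement holding a wide addition, for all nonnegative grid data (`placement_rne_strict`, via the
criterion's necessity `lchain_rne_strict`); and the full unit-roundoff sum of any chain executing
`w` is `U(w)` (`usum_placement`).
-/

namespace Summit.Ventures.CertifiedArithmetic.LowPrec.Opt

open Literature.ComputerArithmetic.JeannerodRump2018

/-! ## Round-to-nearest-even -/

/-- For `q ≥ p + 2` every placement chain satisfies the RNE sharpness criterion (T9(f)(ii)): every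
demotion is fed by a wide addition two or more bits wider. -/
theorem rneGap_placePat {q p : ℕ} (h2 : p + 2 ≤ q) :
    ∀ (w : List Bool) (b first : Bool), RNEGap (stPrec q p b) first (placePat q p b w)
  | [], false, first => by simp [placePat, RNEGap]
  | [], true, first => by
      simp only [stPrec, placePat, RNEGap]
      exact ⟨by omega, Or.inr h2, trivial⟩
  | false :: w, false, first => by
      simp only [stPrec, placePat, RNEGap]
      exact rneGap_placePat h2 w false false
  | true :: w, false, first => by
      simp only [stPrec, placePat, RNEGap]
      exact rneGap_placePat h2 w true false
  | true :: w, true, first => by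
      simp only [stPrec, placePat, RNEGap]
      exact rneGap_placePat h2 w true false
  | false :: w, true, first => by
      simp only [stPrec, placePat, RNEGap]
      exact ⟨by omega, Or.inr h2, rneGap_placePat h2 w false false⟩

/-- For `q = p + 1` a placement chain with a wide addition VIOLATES the RNE criterion: its first
demotion is fed at exactly one more bit. -/
theorem not_rneGap_placePat_succ {p : ℕ} :
    ∀ (w : List Bool) (b first : Bool), (b = true ∨ true ∈ w) → (b = true → first = false) →
      ¬ RNEGap (stPrec (p + 1) p b) first (placePat (p + 1) p b w)
  | [], false, first, h, _ => by simp at h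
  | [], true, first, _, hf => by
      have hf' := hf rfl
      subst hf'
      simp [stPrec, placePat, RNEGap]
  | false :: w, false, first, h, _ => by
      have h' : true ∈ w := by simpa using h
      simp only [stPrec, placePat, RNEGap]
      exact not_rneGap_placePat_succ w false false (Or.inr h') (fun h => by simp at h)
  | true :: w, false, first, _, _ => by
      simp only [stPrec, placePat, RNEGap]
      exact not_rneGap_placePat_succ w true false (Or.inl rfl) (fun _ => rfl)
  | true :: w, true, first, _, _ => by
      simp only [stPrec, placePat, RNEGap]
      exact not_rneGap_placePat_succ w true false (Or.inl rfl) (fun _ => rfl)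
  | false :: w, true, first, _, hf => by
      have hf' := hf rfl
      subst hf'
      simp [stPrec, placePat, RNEGap]

/-- THE PLACEMENT LAW UNDER ROUND-TO-NEAREST-EVEN, `q ≥ p + 2` (T9(h)): EVERY family of
ties-to-even nearest roundings attains `1 + U(w)` on EVERY placement `w`, with the T9(f) witness
data, at every scale clear of underflow. -/
theorem placement_rne_attained {emin E : ℤ} {fl : ℕ → ℚ → ℚ}
    (hfl : ∀ π, IsRoundNearest π emin (fl π) ∧ TiesToEven π emin (fl π))
    {q p : ℕ} (hp : 2 ≤ p) (h2 : p + 2 ≤ q) (hE : emin + q ≤ E) (w : List Bool) :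
    (witSteps fl E (placePat q p false w)).map lpat = placePat q p false w ∧
    (∀ s ∈ witSteps fl E (placePat q p false w), s.OK emin) ∧
    lchainEval ((2 : ℚ) ^ E) (witSteps fl E (placePat q p false w)) = (2 : ℚ) ^ E ∧
    (2 : ℚ) ^ E + xsum (witSteps fl E (placePat q p false w))
      = (1 + placeU q p false w) * (2 : ℚ) ^ E := by
  have hP : ∀ r ∈ placePat q p false w, 2 ≤ r.1 ∧ emin + r.1 ≤ E := by
    intro r hr
    rcases mem_placePat w false r hr with h | h <;> (rw [h]; constructor <;> omega)
  have hgap : RNEGap p true (placePat q p false w) := by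
    simpa [stPrec] using rneGap_placePat h2 w false true
  have h := lchain_rne_attained hfl hp (by omega) (placePat q p false w) hP hgap
  rw [Rsum_placePat] at h
  simp only [add_zero, mul_one] at h
  obtain ⟨-, hok, hev, heq⟩ := h
  refine ⟨map_witSteps fl E _, hok, hev, ?_⟩
  rw [heq, hev, ← ueff_witSteps_eq_usum fl E _ p true hgap, ueff_witSteps,
    ueffP_placePat_start (by omega)]

/-- THE PLACEMENT LAW UNDER ROUND-TO-NEAREST-EVEN, `q = p + 1` (T9(h)): EVERY family of
ties-to-even nearest roundings is STRICT on every placement holding a wide addition — for all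
nonnegative grid data and every start value `acc ∈ F(p)`, `acc + Σ x_i < (1 + Σ u_{π_i}) · S_n`
whenever `S_n > 0` (and `Σ u_{π_i} = U(w)` here, `usum_placement`). -/
theorem placement_rne_strict {emin : ℤ} {p : ℕ} (w : List Bool) (hw : true ∈ w)
    (ss : List LStep) (hpat : ss.map lpat = placePat (p + 1) p false w) (acc : ℚ)
    (hacc0 : 0 ≤ acc) (haccF : IsFloat p emin acc)
    (hss : ∀ s ∈ ss, s.OK emin ∧ TiesToEven s.prec emin s.fl) (hpos : 0 < lchainEval acc ss) :
    acc + xsum ss < (1 + usum ss) * lchainEval acc ss := by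
  refine lchain_rne_strict ss acc hacc0 haccF hss ?_ hpos
  rw [hpat]
  simpa [stPrec] using not_rneGap_placePat_succ w false true (Or.inr hw) (fun h => by simp at h)

/-- In a placement chain every conversion is a genuine demotion, so the full unit-roundoff sum of
any chain executing `w` IS `U(w)`. -/
theorem usum_placement {q p : ℕ} (w : List Bool) (ss : List LStep)
    (hpat : ss.map lpat = placePat q p false w) : usum ss = placeU q p false w := by
  suffices key : ∀ (w : List Bool) (b : Bool) (ss : List LStep),
      ss.map lpat = placePat q p b w → usum ss = placeU q p b w from key w false ss hpat
  intro w
  induction w with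
  | nil =>
      intro b ss h
      cases b with
      | false =>
          cases ss with
          | nil => simp [usum, placeU, nN, nW, newRuns, pend]
          | cons s ss => simp [placePat] at h
      | true =>
          cases ss with
          | nil => simp [placePat] at h
          | cons s ss =>
              cases ss with
              | nil =>
                  simp only [List.map_cons, List.map_nil, placePat, List.cons.injEq, lpat,
                    Prod.mk.injEq] at h
                  simp [usum, placeU, nN, nW, newRuns, pend, h.1.1]
              | cons t ss => simp [placePat] at h
  | cons c w ih =>
      intro b ss h
      cases c with
      | false =>
          cases b with
          | false =>
              cases ss with
              | nil => simp [placePat] at h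
              | cons s ss =>
                  simp only [List.map_cons, placePat, List.cons.injEq, lpat, Prod.mk.injEq] at h
                  rw [usum_cons, ih false ss h.2, h.1.1]
                  simp only [placeU, nN, nW, newRuns, pend]
                  push_cast; ring
          | true =>
              cases ss with
              | nil => simp [placePat] at h
              | cons s ss =>
                  cases ss with
                  | nil => simp [placePat] at h
                  | cons t ss =>
                      simp only [List.map_cons, placePat, List.cons.injEq, lpat,
                        Prod.mk.injEq] at h
                      rw [usum_cons, usum_cons, ih false ss h.2.2, h.1.1, h.2.1.1]
                      simp only [placeU, nN, nW, newRuns, pend]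
                      push_cast; ring
      | true =>
          cases ss with
          | nil => cases b <;> simp [placePat] at h
          | cons s ss =>
              cases b with
              | false =>
                  simp only [List.map_cons, placePat, List.cons.injEq, lpat, Prod.mk.injEq] at h
                  rw [usum_cons, ih true ss h.2, h.1.1]
                  simp only [placeU, nN, nW, newRuns, pend]
                  push_cast; ring
              | true =>
                  simp only [List.map_cons, placePat, List.cons.injEq, lpat, Prod.mk.injEq] at h
                  rw [usum_cons, ih true ss h.2, h.1.1]
                  simp only [placeU, nN, nW, newRuns, pend]
                  push_cast; ring

/-! ## Registered form -/

/-- THE PLACEMENT LAW UNDER ROUND-TO-NEAREST-EVEN (OPTIMA.md §B, T9(h)): (1) `2 ≤ p`,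
`p + 2 ≤ q`: for every placement `w`, every scale `E ≥ emin + q` and EVERY family of ties-to-even
nearest roundings, the witness chain executing `w` with those roundings from `acc = 2^E ∈ F(p)`
has `S_n = 2^E` and `acc + Σ x_i = (1 + U(w)) · S_n`; (2) `q = p + 1`: every admissible chain of
ties-to-even nearest roundings executing a placement with a wide addition, from `acc ∈ F(p)`,
`acc ≥ 0`, with `S_n > 0`, has `acc + Σ x_i < (1 + U(w)) · S_n`. -/
def R4_PlacementLawRNE : Prop :=
  (∀ (q p : ℕ), 2 ≤ p → p + 2 ≤ q → ∀ (emin E : ℤ) (w : List Bool), emin + q ≤ E →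
    ∀ fl : ℕ → ℚ → ℚ, (∀ π, IsRoundNearest π emin (fl π) ∧ TiesToEven π emin (fl π)) →
      ∃ ws : List LStep, ws.map lpat = placePat q p false w ∧ (∀ s ∈ ws, s.fl = fl s.prec) ∧
        (∀ s ∈ ws, s.OK emin) ∧ lchainEval ((2 : ℚ) ^ E) ws = (2 : ℚ) ^ E ∧
        (2 : ℚ) ^ E + xsum ws = (1 + placeU q p false w) * lchainEval ((2 : ℚ) ^ E) ws) ∧
  (∀ (p : ℕ) (emin : ℤ) (w : List Bool), true ∈ w → ∀ (ss : List LStep) (acc : ℚ),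
    ss.map lpat = placePat (p + 1) p false w → 0 ≤ acc → IsFloat p emin acc →
    (∀ s ∈ ss, s.OK emin ∧ TiesToEven s.prec emin s.fl) → 0 < lchainEval acc ss →
    acc + xsum ss < (1 + placeU (p + 1) p false w) * lchainEval acc ss)

/-- `R4_PlacementLawRNE` holds. -/
theorem R4_PlacementLawRNE_holds : R4_PlacementLawRNE := by
  refine ⟨?_, ?_⟩
  · intro q p hp h2 emin E w hE fl hfl
    obtain ⟨hmap, hok, hev, heq⟩ := placement_rne_attained hfl hp h2 hE w
    refine ⟨witSteps fl E (placePat q p false w), hmap, fl_witSteps fl E _, hok, hev, ?_⟩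
    rw [hev]; exact heq
  · intro p emin w hw ss acc hpat hacc0 haccF hss hpos
    have h := placement_rne_strict w hw ss hpat acc hacc0 haccF hss hpos
    rwa [usum_placement w ss hpat] at h

end Summit.Ventures.CertifiedArithmetic.LowPrec.Opt
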